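import Literature.AnabelianGeometry.SemiGraphs.OrbitGraphCyclomaticCount
import Literature.AnabelianGeometry.SemiGraphs.TemperedPiChartVirtuallyFreeTower
import Literature.AnabelianGeometry.SemiGraphs.TemperedVerticialInjective
import Literature.GroupTheory.CombinatorialGroupTheory.FreeGroupoidRank
import HarnessLib

/-!
# A Galois level with non-abelian graph fundamental group: the virtually free tower of
# `π₁^temp(𝒢)` at the model, unconditionally for finite graphs with a closed edge
# ([SemiAnbd] Prop. 3.6 p. 38; Def. 2.4 (i) p. 25; [André 2003] §4.5)

Mochizuki, *Semi-graphs of anabelioids*, Publ. RIMS **42** (2006) [SemiAnbd], Prop. 3.6 p. 38: for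
`𝒢` (connected, countable, quasi-coherent, totally elevated, totally aloof, verticially slim) "Let
`{𝒢_i → 𝒢}_{i ∈ I}` be some cofinal collection of connected finite étale Galois coverings … `𝒢_{∞,i}`
the [tempered] covering determined by the universal graph-covering of the underlying semi-graph `𝔾_i`
of `𝒢_i` … `π₁^temp(𝒢) := lim Gal(𝒢_{∞,i}/𝒢)`", and Def. 2.4 (i) p. 25 (total elevation).
[cite: MochizukiSemiAnbd2006, Prop 3.6 p.38]

PROOF-ONLY file (abc-iut cell, prover abc-iut-w5-d240; no definitions).  The André tower property
`htower₀` of `π₁^temp(𝒢)` — cofinal open normal subgroups `N` with `π₁^temp(𝒢)/N` containing a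
free, normal, finite-index, finite-rank, non-abelian subgroup — was proved at the model
`𝒢.temperedPi h36` and for every chart (`TemperedPiVirtuallyFreeTower`,
`TemperedPiChartVirtuallyFreeTower`, abc-iut-w5-d139) MODULO the one hypothesis `hnonab`: some Galois
level `𝒢_n` of `galoisLevelData h36` has non-abelian graph fundamental group `π₁(𝔾_n, [x_n])`.
This file DISCHARGES `hnonab` for every `𝒢` whose underlying semi-graph is finite with at least one
closed edge:

* `galoisLevelData_eventually_dominates` — the Galois tower eventually dominates every approximator
  `G → G'`: from some level on, every stabiliser of the `v`-constituent of `𝒢_n` lies in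
  `Ker(Π_v → Π'_v)` (the trivialising covering `Approximator.trivCov` of the approximator, proof of
  Prop. 2.5 (i) p. 27, is finite, hence split by a member of the Galois-countability family, [IUTchI]
  Rmk. 2.5.3 (i) (T2), which the tower dominates, `galoisTowerToX`);
* `SemiGraph.exists_abuts_isClosedEdge` — in a connected semi-graph with a closed edge every vertex
  abuts to a closed edge;
* `galoisLevelData_exists_not_commute` — at a level dominating `(#vertices + 1)`-elevation
  approximators at all vertices (total elevation), the orbit count `CovObj.cyclomatic_count`
  (`OrbitGraphCyclomaticCount.lean`) makes the cyclomatic number of `𝔾_n` at least `2`, so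
  `π₁(𝔾_n, [x_n])` contains two non-commuting loops (`SemiGraph.exists_not_commute_fundamentalGroup`,
  `FreeGroupoidRank.lean`);
* `temperedPi_tower_of_isClosedEdge`, `TemperedPiChart.tower_of_isClosedEdge` — `htower₀` for
  `𝒢.temperedPi h36` and for every tempered fundamental group chart, with hypotheses: `Prop36Hypotheses`,
  finitely many vertices and edges, one closed edge.  The closed edge cannot be dropped: for one vertex
  carrying only cusps `π₁^temp(𝒢) = Π_v` is profinite and the tower fails
  (`TemperedAnabelianTowerNecessity.lean`).

Consumers: the cell's [SemiAnbd] §6 / [EtTh] Lem. 2.17 (ii) reductions taking `htower₀` BY NAME.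
Nothing here bears on [IUTchIII] Cor. 3.12 or takes a side on any disputed claim.
-/

noncomputable section

namespace Literature.AnabelianGeometry.SemiGraphs

namespace ProfiniteSemiGraph

open CategoryTheory
open Literature.GroupTheory.CombinatorialGroupTheory

universe u

/-! ### 4. The Galois levels of Prop. 3.6 eventually dominate every approximator -/

section Model

variable (𝒢 : ProfiniteSemiGraph.{u}) (h36 : 𝒢.Prop36Hypotheses)

/-- Transition morphisms `𝒢_m → 𝒢_n` of Galois level data for `n ≤ m` (composites of the `g k`).
[cite: MochizukiSemiAnbd2006, Prop 3.6 p.38] -/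
theorem GaloisLevelData.nonempty_hom_of_le {𝒢 : ProfiniteSemiGraph.{u}} (D : GaloisLevelData 𝒢)
    {n m : ℕ} (h : n ≤ m) : Nonempty (D.S m ⟶ D.S n) := by
  induction m, h using Nat.le_induction with
  | base => exact ⟨𝟙 _⟩
  | succ k _ ih =>
    obtain ⟨t⟩ := ih
    exact ⟨D.g k ≫ t⟩

/-- **The Galois tower of Prop. 3.6 eventually dominates every approximator.**  For an approximator
`G → G'` (Def. 2.3), from some level on every stabiliser of the `v`-constituent of the Galois level
`𝒢_n` (`galoisLevelData h36`) lies in `Ker(Π_v → Π'_v)`: the trivialising covering of the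
approximator (proof of Prop. 2.5 (i), `Approximator.trivCov`) is finite, hence split by a member of
the Galois-countability family ([IUTchI] Rmk. 2.5.3 (i) (T2)), which the tower dominates
(`galoisTowerToX`). [cite: MochizukiSemiAnbd2006, Prop 3.6 p.38] -/
theorem galoisLevelData_eventually_dominates (A : 𝒢.Approximator) :
    ∃ i : ℕ, ∀ n, i ≤ n → ∀ (v : 𝒢.graph.Vertex) (x : (((𝒢.galoisLevelData h36).S n).SV v).obj.V)
      (p : 𝒢.Gv v), (((𝒢.galoisLevelData h36).S n).SV v).obj.ρ p x = x → A.πV v p = 1 := by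
  classical
  obtain ⟨M, hM, hdvd⟩ := A.bounded
  let hgc := h36.isGaloisCountable
  obtain ⟨i, hspl⟩ := hgc.2.choose_spec.2 (A.trivCov hM hdvd) (A.trivCov_isFinite hM hdvd)
  refine ⟨i, fun n hn v x p hpx => ?_⟩
  letI := SemiGraphOfAnabelioids.galoisCategory_bObj 𝒢.toAnab ⟨h36.isConnected⟩
  haveI := 𝒢.fiberFunctor_fiberAt h36.isConnected (𝒢.baseVertex h36)
  -- `𝒢_n → 𝒢_i → F_i`, `F_i` the `i`-th member of the Galois-countability family
  obtain ⟨t⟩ := (𝒢.galoisLevelData h36).nonempty_hom_of_le hn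
  let u : (𝒢.galoisLevelData h36).S i ⟶ hgc.2.choose i :=
    𝒢.ofBObj.map (Literature.AnabelianGeometry.Anabelioids.galoisTowerToX
        (𝒢.fiberAt (𝒢.baseVertex h36)) (𝒢.gcFamily hgc)
        (𝒢.nonempty_fiberAt_gcFamily hgc (𝒢.baseVertex h36)) i) ≫
      (ofBObjIso (hgc.2.choose i) (hgc.2.choose_spec.1 i).1).hom
  let y : ((hgc.2.choose i).SV v).obj.V := ((t ≫ u).fV v).hom.hom x
  have hy : ((hgc.2.choose i).SV v).obj.ρ p y = y := by
    change ((hgc.2.choose i).SV v).obj.ρ p (((t ≫ u).fV v).hom.hom x) = ((t ≫ u).fV v).hom.hom x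
    rw [← CovHom.fV_ρ (t ≫ u) v p x]
    exact congrArg _ hpx
  -- `F_i` splits the trivialising covering, whose `v`-stabilisers are `Ker(Π_v → Π'_v)`
  obtain ⟨s⟩ := (A.trivCov_hasNonemptyFibres hM hdvd).nonempty_V v
  have hs : (A.πV v p * s.1, s.2) = s := (A.objV_ρ M v p s).symm.trans (hspl.1 v y p hy s)
  exact mul_eq_right.mp (Prod.ext_iff.mp hs).1

/-! ### 5. A Galois level with non-abelian graph fundamental group -/

/-- In a connected semi-graph with a closed edge, every vertex abuts to a closed edge (walk in the
barycentric subdivision from the vertex to the closed edge: it leaves through an abutting branch, and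
the edge of that branch is either the target or is left again through its other branch towards a
vertex). [cite: MochizukiSemiAnbd2006, §1 p.12] -/
theorem _root_.Literature.AnabelianGeometry.SemiGraphs.SemiGraph.exists_abuts_isClosedEdge
    {G : SemiGraph.{u}} (hG : G.IsConnected) {e₀ : G.Edge} (he₀ : G.IsClosedEdge e₀)
    (v : G.Vertex) : ∃ b : G.Branch, G.abuts b = some v ∧ G.IsClosedEdge (G.edgeOf b) := by
  classical
  obtain ⟨p, hp⟩ := hG.connected.exists_isPath (Sum.inl v) (Sum.inr (Sum.inl e₀))
  have hinj : ∀ i j : ℕ, i ≤ p.length → j ≤ p.length → p.getVert i = p.getVert j → i = j :=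
    fun i j hi hj h => hp.getVert_injOn hi hj h
  have hl0 : p.length ≠ 0 := fun h => by
    have := p.eq_of_length_eq_zero h
    simp at this
  -- node 1: a branch `b` abutting to `v`
  have h01 := p.adj_getVert_succ (i := 0) (by omega)
  rw [p.getVert_zero] at h01
  obtain ⟨b, hbv, h1⟩ := (G.subdivision_adj_inl_iff v _).mp h01
  have hl1 : p.length ≠ 1 := fun h => by
    have h2 : p.getVert 1 = Sum.inr (Sum.inl e₀) := h ▸ p.getVert_length
    rw [h1] at h2
    simp at h2
  -- node 2: the edge of `b`
  have h12 := p.adj_getVert_succ (i := 1) (by omega)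
  rw [h1] at h12
  rcases (G.subdivision_adj_branch_iff b _).mp h12 with h2 | ⟨w, hw, h2⟩
  swap
  · exfalso
    rw [hbv] at hw
    cases hw
    have : (2 : ℕ) = 0 := hinj 2 0 (by omega) (by omega) (by rw [h2, p.getVert_zero])
    omega
  by_cases he : G.edgeOf b = e₀
  · exact ⟨b, hbv, he ▸ he₀⟩
  -- otherwise the walk goes on: node 3 is the other branch `b'` of `edgeOf b`, node 4 a vertex
  have hl2 : p.length ≠ 2 := fun h => by
    have h3 : p.getVert 2 = Sum.inr (Sum.inl e₀) := h ▸ p.getVert_length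
    rw [h2] at h3
    exact he (by simpa using h3)
  have h23 := p.adj_getVert_succ (i := 2) (by omega)
  rw [h2] at h23
  obtain ⟨b', hb'e, h3⟩ := (G.subdivision_adj_edge_iff _ _).mp h23
  have hbb' : b' ≠ b := by
    rintro rfl
    have : (3 : ℕ) = 1 := hinj 3 1 (by omega) (by omega) (by rw [h3, h1])
    omega
  have hl3 : p.length ≠ 3 := fun h => by
    have h4 : p.getVert 3 = Sum.inr (Sum.inl e₀) := h ▸ p.getVert_length
    rw [h3] at h4
    simp at h4
  have h34 := p.adj_getVert_succ (i := 3) (by omega)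
  rw [h3] at h34
  rcases (G.subdivision_adj_branch_iff b' _).mp h34 with h4 | ⟨w, hw, -⟩
  · exfalso
    have : (4 : ℕ) = 2 := hinj 4 2 (by omega) (by omega) (by rw [h4, h2, hb'e])
    omega
  -- `edgeOf b` has the two abutting branches `b ≠ b'`: it is closed
  refine ⟨b, hbv, ?_⟩
  unfold SemiGraph.IsClosedEdge SemiGraph.vertCard
  refine Nat.card_eq_two_iff.mpr ⟨⟨b, rfl, by rw [hbv]; rfl⟩, ⟨b', hb'e, by rw [hw]; rfl⟩,
    fun h => hbb' (congrArg Subtype.val h).symm, ?_⟩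
  refine Set.eq_univ_of_forall fun z => ?_
  obtain ⟨b₁, b₂, -, -, -, hall⟩ := G.two_branches (G.edgeOf b)
  rcases hall z.1 z.2.1 with hz | hz <;> rcases hall b rfl with hb | hb <;>
    rcases hall b' hb'e with hb' | hb'
  all_goals first
    | exact absurd (hb'.trans hb.symm) hbb'
    | (left; exact Subtype.ext (hz.trans hb.symm))
    | (right; exact Subtype.ext (hz.trans hb'.symm))

/-- **A Galois level with non-abelian graph fundamental group.**  Let `𝒢` satisfy the hypotheses of
Prop. 3.6 with finitely many vertices and edges, every vertex abutting to a closed edge.  Then for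
some level `𝒢_n` of the Galois tower `galoisLevelData h36` the graph fundamental group
`π₁(𝔾_n, [x_n])` is non-abelian: at a level dominating `(#vertices + 1)`-elevation approximators at
all vertices (total elevation, Def. 2.4 (i); `galoisLevelData_eventually_dominates`) the orbit count
`CovObj.cyclomatic_count` gives cyclomatic number `≥ 2`, and
`SemiGraph.exists_not_commute_fundamentalGroup` two non-commuting loops.
[cite: MochizukiSemiAnbd2006, Prop 3.6 p.38] -/
theorem galoisLevelData_exists_not_commute [Finite 𝒢.graph.Vertex] [Finite 𝒢.graph.Edge]
    (hve : ∀ v : 𝒢.graph.Vertex, ∃ b : 𝒢.graph.Branch,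
      𝒢.graph.abuts b = some v ∧ 𝒢.graph.IsClosedEdge (𝒢.graph.edgeOf b)) :
    ∃ (n : ℕ) (a b : ((𝒢.galoisLevelData h36).S n).orbitGraph.FundamentalGroup
      (((𝒢.galoisLevelData h36).S n).baseComp (𝒢.galoisLevelData h36).v₀
        ((𝒢.galoisLevelData h36).x n))), a * b ≠ b * a := by
  classical
  letI : Fintype 𝒢.graph.Vertex := Fintype.ofFinite _
  -- elevation approximators of order `> #vertices` at every vertex, and a level dominating them all
  have hel := fun v => h36.isTotallyElevated v (Nat.card 𝒢.graph.Vertex + 1)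
  choose A hepi N hMN hNel using hel
  choose i hi using fun v => 𝒢.galoisLevelData_eventually_dominates h36 (A v)
  let n : ℕ := Finset.univ.sup i
  have hn : ∀ v, i v ≤ n := fun v => Finset.le_sup (Finset.mem_univ v)
  let S : CovObj 𝒢 := (𝒢.galoisLevelData h36).S n
  have hS : S.IsFinite := 𝒢.ofBObj_isFinite (𝒢.tower h36 n)
  haveI : Finite S.orbitGraph.Vertex := S.finite_oVertex hS
  haveI : Finite S.orbitGraph.Edge := S.finite_oEdge hS
  haveI : Finite S.orbitGraph.Branch := S.finite_orbitGraph_branch hS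
  refine ⟨n, SemiGraph.exists_not_commute_fundamentalGroup S.orbitGraph _
    (𝒢.galoisLevelData_nonempty_hom_baseComp h36 n) ?_⟩
  exact S.cyclomatic_count hS h36.isConnected (𝒢.galoisLevelData h36).v₀
    ((𝒢.galoisLevelData h36).x n) hve fun v =>
    ⟨A v, (hepi v).1 v, ⟨N v, hMN v, hNel v⟩, hi v n (hn v) v⟩

/-- **[SemiAnbd] Prop. 3.6 / [André 2003] §4.5 — the virtually free tower of `π₁^temp(𝒢)` AT THE
MODEL, unconditionally for finite graphs with a closed edge.**  For a semi-graph of anabelioids `𝒢`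
satisfying the hypotheses of Prop. 3.6 whose underlying semi-graph is finite with at least one CLOSED
edge, the tempered fundamental group `𝒢.temperedPi h36` has the tower property `htower₀`: cofinal
open normal subgroups `N` with `π₁^temp(𝒢)/N` containing a free, normal, finite-index, finite-rank,
non-abelian subgroup (`temperedPi_tower` with its hypothesis `hnonab` DISCHARGED by
`galoisLevelData_exists_not_commute`).  The closed edge is needed: for one vertex with only cusps
`π₁^temp(𝒢) = Π_v` is profinite and the tower fails (`TemperedAnabelianTowerNecessity`).
[cite: MochizukiSemiAnbd2006, Prop 3.6(i) p.38] -/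
theorem temperedPi_tower_of_isClosedEdge [Finite 𝒢.graph.Vertex] [Finite 𝒢.graph.Edge]
    (hcl : ∃ e : 𝒢.graph.Edge, 𝒢.graph.IsClosedEdge e) :
    ∀ U ∈ nhds (1 : 𝒢.temperedPi h36), ∃ N : OpenNormalSubgroup (𝒢.temperedPi h36),
      (N : Set (𝒢.temperedPi h36)) ⊆ U ∧
      ∃ (G : Subgroup (𝒢.temperedPi h36 ⧸ N.toSubgroup)) (_ : IsFreeGroup G), G.Normal ∧
        G.FiniteIndex ∧ Finite (IsFreeGroup.Generators G) ∧ ∃ a ∈ G, ∃ b ∈ G, a * b ≠ b * a := by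
  obtain ⟨e₀, he₀⟩ := hcl
  exact 𝒢.temperedPi_tower h36 (𝒢.galoisLevelData_exists_not_commute h36
    (SemiGraph.exists_abuts_isClosedEdge h36.isConnected he₀))

/-- **The virtually free tower for EVERY tempered fundamental group chart**, unconditionally for
finite graphs with a closed edge: for `𝒢` satisfying the hypotheses of Prop. 3.6 with finitely many
vertices and edges and a closed edge, the group `c.G` of every chart `c` has cofinally many open
normal subgroups `N` with `c.G/N` containing a free, normal, finite-index, finite-rank, non-abelian
subgroup (`TemperedPiChart.tower` with `hnonab` discharged) — the André tower input `htower₀` of the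
cell's [SemiAnbd] §6 / [EtTh] 2.17 (ii) reductions, as a THEOREM at the model.
[cite: MochizukiSemiAnbd2006, Prop 3.6 p.38] -/
theorem TemperedPiChart.tower_of_isClosedEdge {𝒢 : ProfiniteSemiGraph.{u}} (c : TemperedPiChart 𝒢)
    (h36 : 𝒢.Prop36Hypotheses) [Finite 𝒢.graph.Vertex] [Finite 𝒢.graph.Edge]
    (hcl : ∃ e : 𝒢.graph.Edge, 𝒢.graph.IsClosedEdge e) :
    ∀ U ∈ nhds (1 : c.G), ∃ N : OpenNormalSubgroup c.G, (N : Set c.G) ⊆ U ∧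
      ∃ (G : Subgroup (c.G ⧸ N.toSubgroup)) (_ : IsFreeGroup G), G.Normal ∧ G.FiniteIndex ∧
        Finite (IsFreeGroup.Generators G) ∧ ∃ a ∈ G, ∃ b ∈ G, a * b ≠ b * a := by
  obtain ⟨e₀, he₀⟩ := hcl
  exact c.tower h36 (𝒢.galoisLevelData_exists_not_commute h36
    (SemiGraph.exists_abuts_isClosedEdge h36.isConnected he₀))

end Model

end ProfiniteSemiGraph

end Literature.AnabelianGeometry.SemiGraphs

end
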